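import Summits.Ventures.PercRepro.SMC4

/-!
# The finite model of merge types along an edge (behind `TypeIdentity`)

`TypeIdentity` (typer-2, `Lemma6.lean`) is the identity `Q⁺(Δ_g, Δ_g) = sixMarkLHS − sixMarkRHS`
of the C-011 dossier §1–§3.  Its combinatorial content is a statement about ONE configuration
`ω`: opening the edge `g = uv` changes the marked partition of `a, b, c, d` (in `G − g`) by at most
one merge, and the merge vector `e_{row(ω[g:=1])} − e_{row(ω[g:=0])}` is determined by the type of
`ω` (`A_i, B_i, C_i, D_i, E` of `Concavity6.lean`, or no move).  This file proves that
classification by reducing it to a FINITE model: the connectivity pattern of the four marks in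
`G − g` is one of the 15 row patterns (`pat s`), the attachments of `u` and `v` to the marks are
two subsets (`au av : Fin 4 → Bool`), the consistency conditions are those of an equivalence
relation (`Consistent`), and the pattern after opening `g` is `after` (`conn_update_true_iff`).
Everything about the model is decided by the kernel (`decide +kernel` over the `15 · 2⁸ · 2`
consistent cases); the graph side is the bridge `patOf_eq_pat`, `patAfter_eq_after`,
`mem_typeA_iff_bits`, …, so that for every `ω` the merge vector is `mv (row ω) (au ω) (av ω)` and
the type events are the bit predicates.  The bilinear values `Q⁺(v, v')` on the merge vectors of
two types are the sign table of §2 (`quadPlus_variants`).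
-/

namespace PercRepro

namespace Merge4

/-! ### The finite model -/

/-- The equality pattern of the engine row `s` of `Part(4)` (`rgs4`). -/
def pat (s : Fin 15) : Fin 4 → Fin 4 → Bool := fun i j => decide (rgs4 s i = rgs4 s j)

/-- The pattern after opening the edge `uv`: `i ~ j` already, or `i ~ u, v ~ j`, or `i ~ v, u ~ j`. -/
def after (P : Fin 4 → Fin 4 → Bool) (au av : Fin 4 → Bool) : Fin 4 → Fin 4 → Bool :=
  fun i j => P i j || (au i && av j) || (av i && au j)

/-- The row of a pattern (`none` if it is not an equality pattern of a row). -/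
def rowOf (P : Fin 4 → Fin 4 → Bool) : Option (Fin 15) :=
  (List.finRange 15).find? fun s => ∀ i j, P i j = pat s i j

/-- Consistency of a pattern with two attachment sets: the attachments are unions of classes,
marks attached to the same endpoint are connected, and `u ~ v` (`uv`) iff the attachment sets
meet. -/
def Consistent (P : Fin 4 → Fin 4 → Bool) (au av : Fin 4 → Bool) (uv : Bool) : Prop :=
  (∀ i j, au i → P i j → au j) ∧ (∀ i j, av i → P i j → av j) ∧
    (∀ i j, au i → au j → P i j) ∧ (∀ i j, av i → av j → P i j) ∧
    (uv → ∀ i, au i = av i) ∧ (∀ i, au i → av i → uv)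

/-- Consistency of a (pattern, attachments, endpoint bit) quadruple is decidable on finite data. -/
instance (P : Fin 4 → Fin 4 → Bool) (au av : Fin 4 → Bool) (uv : Bool) :
    Decidable (Consistent P au av uv) := by unfold Consistent; infer_instance

/-! ### The type predicates on bits (mirroring `Concavity6.lean` verbatim) -/

/-- The two blocks of the crossing cells, as mark indices (`a b c d = 0 1 2 3`). -/
def blk : Fin 3 → (Fin 4 × Fin 4) × (Fin 4 × Fin 4) :=
  ![((0, 1), (2, 3)), ((0, 2), (1, 3)), ((0, 3), (1, 2))]

/-- `linksPair`: `u ~ p ∧ v ~ q` or `u ~ q ∧ v ~ p`. -/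
def linksB (au av : Fin 4 → Bool) (p q : Fin 4) : Bool :=
  (au p && av q) || (au q && av p)

/-- `isRank1Cell p q s s'`. -/
def rank1B (P : Fin 4 → Fin 4 → Bool) (p q s s' : Fin 4) : Bool :=
  P p q && !P p s && !P p s' && !P q s && !P q s' && !P s s'

/-- `isCrossCell p q p' q'`. -/
def crossB (P : Fin 4 → Fin 4 → Bool) (p q p' q' : Fin 4) : Bool := P p q && P p' q' && !P p p'

/-- `isThreeOneCell p q r s`. -/
def threeOneB (P : Fin 4 → Fin 4 → Bool) (p q r s : Fin 4) : Bool := P p q && P q r && !P p s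

/-- `sepAllFour`. -/
def sepAllB (P : Fin 4 → Fin 4 → Bool) : Bool :=
  !P 0 1 && !P 0 2 && !P 0 3 && !P 1 2 && !P 1 3 && !P 2 3

/-- Type `Aᵢ` on bits. -/
def typeAB (P : Fin 4 → Fin 4 → Bool) (au av : Fin 4 → Bool) (i : Fin 3) : Bool :=
  sepAllB P && (linksB au av (blk i).1.1 (blk i).1.2 || linksB au av (blk i).2.1 (blk i).2.2)

/-- Type `Bᵢ` on bits. -/
def typeBB (P : Fin 4 → Fin 4 → Bool) (au av : Fin 4 → Bool) (i : Fin 3) : Bool :=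
  (rank1B P (blk i).2.1 (blk i).2.2 (blk i).1.1 (blk i).1.2 &&
      linksB au av (blk i).1.1 (blk i).1.2) ||
    (rank1B P (blk i).1.1 (blk i).1.2 (blk i).2.1 (blk i).2.2 &&
      linksB au av (blk i).2.1 (blk i).2.2)

/-- Type `Cᵢ` on bits. -/
def typeCB (P : Fin 4 → Fin 4 → Bool) (au av : Fin 4 → Bool) (i : Fin 3) : Bool :=
  (rank1B P (blk i).1.1 (blk i).1.2 (blk i).2.1 (blk i).2.2 &&
      (linksB au av (blk i).1.1 (blk i).2.1 || linksB au av (blk i).1.1 (blk i).2.2)) ||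
    (rank1B P (blk i).2.1 (blk i).2.2 (blk i).1.1 (blk i).1.2 &&
      (linksB au av (blk i).2.1 (blk i).1.1 || linksB au av (blk i).2.1 (blk i).1.2))

/-- Type `Dᵢ` on bits. -/
def typeDB (P : Fin 4 → Fin 4 → Bool) (au av : Fin 4 → Bool) (i : Fin 3) : Bool :=
  crossB P (blk i).1.1 (blk i).1.2 (blk i).2.1 (blk i).2.2 && linksB au av (blk i).1.1 (blk i).2.1

/-- Type `E` on bits. -/
def typeEB (P : Fin 4 → Fin 4 → Bool) (au av : Fin 4 → Bool) : Bool :=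
  (threeOneB P 1 2 3 0 && linksB au av 1 0) || (threeOneB P 0 2 3 1 && linksB au av 0 1) ||
    (threeOneB P 0 1 3 2 && linksB au av 0 2) || (threeOneB P 0 1 2 3 && linksB au av 0 3)

/-- The 13 merge types: `A i`, `B i`, `C i`, `D i` (`i : Fin 3`) and `E`. -/
inductive MType
  | A (i : Fin 3) | B (i : Fin 3) | C (i : Fin 3) | D (i : Fin 3) | E
  deriving DecidableEq, Repr

/-- The type of a pattern/attachment triple, if any. -/
def typeOf (P : Fin 4 → Fin 4 → Bool) (au av : Fin 4 → Bool) : Option MType :=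
  if typeEB P au av then some .E else
  match (List.finRange 3).find? (typeAB P au av) with
  | some i => some (.A i)
  | none => match (List.finRange 3).find? (typeBB P au av) with
    | some i => some (.B i)
    | none => match (List.finRange 3).find? (typeCB P au av) with
      | some i => some (.C i)
      | none => match (List.finRange 3).find? (typeDB P au av) with
        | some i => some (.D i)
        | none => none

/-- The integer merge vector of the model: `e_{row after} − e_s` (`0` if the row does not move). -/
def mv (s : Fin 15) (au av : Fin 4 → Bool) : Fin 15 → ℤ :=
  match rowOf (after (pat s) au av) with
  | some t => fun r => (if t = r then 1 else 0) - (if s = r then 1 else 0)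
  | none => fun _ => 0

/-- Unit vector. -/
def e (t : Fin 15) : Fin 15 → ℤ := fun r => if t = r then 1 else 0

/-- The admissible merge vectors of each type (`e_after − e_before`): `A i`: `⊥ → R ⋖ xᵢ` (two
rank-1 cells), `B i`: `R ⋖ xᵢ → xᵢ`, `C i`: `R ⋖ xᵢ → 3|1`, `D i`: `xᵢ → ⊤`, `E`: `3|1 → ⊤`. -/
def variants : MType → List (Fin 15 → ℤ)
  | .A 0 => [e 4 - e 14, e 13 - e 14]
  | .A 1 => [e 7 - e 14, e 12 - e 14]
  | .A 2 => [e 11 - e 14, e 10 - e 14]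
  | .B 0 => [e 3 - e 4, e 3 - e 13]
  | .B 1 => [e 6 - e 7, e 6 - e 12]
  | .B 2 => [e 8 - e 11, e 8 - e 10]
  | .C 0 => [e 1 - e 4, e 2 - e 4, e 5 - e 13, e 9 - e 13]
  | .C 1 => [e 1 - e 7, e 5 - e 7, e 2 - e 12, e 9 - e 12]
  | .C 2 => [e 2 - e 11, e 5 - e 11, e 1 - e 10, e 9 - e 10]
  | .D 0 => [e 0 - e 3]
  | .D 1 => [e 0 - e 6]
  | .D 2 => [e 0 - e 8]
  | .E => [e 0 - e 1, e 0 - e 2, e 0 - e 5, e 0 - e 9]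

/-- **The classification, decided by the kernel**: for every consistent `(s, au, av, uv)`, either
no type holds and the row does not move, or exactly the type `typeOf` holds and the merge vector
is one of its variants. -/
theorem classify : ∀ (s : Fin 15) (au av : Fin 4 → Bool) (uv : Bool),
    Consistent (pat s) au av uv →
      (typeOf (pat s) au av = none → mv s au av = fun _ => 0) ∧
      (∀ T, typeOf (pat s) au av = some T → mv s au av ∈ variants T) := by
  decide +kernel

/-- The types are mutually exclusive on consistent data: the bit predicates agree with `typeOf`. -/
theorem types_exclusive : ∀ (s : Fin 15) (au av : Fin 4 → Bool) (uv : Bool),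
    Consistent (pat s) au av uv →
      (∀ i, typeAB (pat s) au av i = true ↔ typeOf (pat s) au av = some (.A i)) ∧
      (∀ i, typeBB (pat s) au av i = true ↔ typeOf (pat s) au av = some (.B i)) ∧
      (∀ i, typeCB (pat s) au av i = true ↔ typeOf (pat s) au av = some (.C i)) ∧
      (∀ i, typeDB (pat s) au av i = true ↔ typeOf (pat s) au av = some (.D i)) ∧
      (typeEB (pat s) au av = true ↔ typeOf (pat s) au av = some .E) := by
  decide +kernel

/-! ### The bilinear form on merge vectors: the sign table of §2 -/

/-- `crossOf` on integer vectors. -/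
def crossZ (u : Fin 15 → ℤ) : Fin 3 → ℤ := ![u 3, u 6, u 8]

/-- `rank1Of` on integer vectors. -/
def rank1Z (u : Fin 15 → ℤ) : Fin 3 → ℤ := ![u 4 + u 13, u 7 + u 12, u 11 + u 10]

/-- `2 · Q⁺` on integer vectors (integer-valued). -/
def quad2 (u v : Fin 15 → ℤ) : ℤ :=
  (u 0 * v 14 + u 14 * v 0) -
    (∑ i : Fin 3, ∑ j : Fin 3, if i ≠ j then crossZ u i * crossZ v j else 0) -
    (∑ i : Fin 3, ∑ j : Fin 3, if i ≠ j then
      crossZ u i * rank1Z v j + rank1Z u j * crossZ v i else 0)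

/-- The sign table of §2 for `2 · Q⁺` on pairs of merge types: `+1` on `Bᵢ × Bⱼ`, `Bᵢ × Cⱼ`,
`Cᵢ × Bⱼ` (`i ≠ j`); `−1` on `Aᵢ × Bⱼ`, `Bⱼ × Aᵢ` (`i ≠ j`), `Aᵢ × Dᵢ`, `Dᵢ × Aᵢ`, `Aᵢ × E`,
`E × Aᵢ`, `Cᵢ × Dⱼ`, `Dⱼ × Cᵢ` (`i ≠ j`), `Dᵢ × Dⱼ` (`i ≠ j`); `0` otherwise. -/
def K : MType → MType → ℤ
  | .B i, .B j => if i ≠ j then 1 else 0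
  | .B i, .C j => if i ≠ j then 1 else 0
  | .C i, .B j => if i ≠ j then 1 else 0
  | .A i, .B j => if i ≠ j then -1 else 0
  | .B j, .A i => if i ≠ j then -1 else 0
  | .A i, .D j => if i = j then -1 else 0
  | .D j, .A i => if i = j then -1 else 0
  | .A _, .E => -1
  | .E, .A _ => -1
  | .C i, .D j => if i ≠ j then -1 else 0
  | .D j, .C i => if i ≠ j then -1 else 0
  | .D i, .D j => if i ≠ j then -1 else 0
  | _, _ => 0

/-- All 13 types, for the finite checks. -/
def allTypes : List MType :=
  [.A 0, .A 1, .A 2, .B 0, .B 1, .B 2, .C 0, .C 1, .C 2, .D 0, .D 1, .D 2, .E]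

/-- Every type is in the list. -/
theorem mem_allTypes (T : MType) : T ∈ allTypes := by
  cases T with
  | E => simp [allTypes]
  | A i => fin_cases i <;> simp [allTypes]
  | B i => fin_cases i <;> simp [allTypes]
  | C i => fin_cases i <;> simp [allTypes]
  | D i => fin_cases i <;> simp [allTypes]

/-- **The sign table, decided by the kernel**: `2 · Q⁺(v, v') = K T T'` for all variants `v` of
`T` and `v'` of `T'`. -/
theorem quad2_variants : ∀ T ∈ allTypes, ∀ T' ∈ allTypes,
    ∀ v ∈ variants T, ∀ v' ∈ variants T', quad2 v v' = K T T' := by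
  decide +kernel

/-- The row pattern is read back as its row. -/
theorem rowOf_pat : ∀ s : Fin 15, rowOf (pat s) = some s := by decide

end Merge4

end PercRepro
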